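import Mathlib
import Summits.Ventures.PercRepro2.Defs
import Summits.Ventures.PercRepro2.Harris
import Summits.Ventures.PercRepro2.Graph
import Summits.Ventures.PercRepro2.Events
import Summits.Ventures.PercRepro2.BHKEvents
import Summits.Ventures.PercRepro2.RProduct

/-!
# The avoidance-weighted centred product of two cluster memberships is nonnegative
(blind cell PercRepro2, mine-2 g20; proofs/MINE2-CUTU.md Theorem 3 (the β → 0 case) and M2-42)

One source `s`, three vertices `x, y, z`, product Bernoulli weights `p`; `L_v = 1[v ∈ C_s]`,
`τ_v = P(s ↔ v)`, `R_z = {s ↮ z}`.  **Theorem `centred_avoid_nonneg`:**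

  `E[(L_x − τ_x)(L_y − τ_y) · 1_{R_z}] ≥ 0`,

multiplied out: `P(s↔x, s↔y, s↮z) − τ_x P(s↔y, s↮z) − τ_y P(s↔x, s↮z) + τ_x τ_y P(s↮z) ≥ 0`.

Proof: with `a = P(s↔x, s↮z)`, `b = P(s↔y, s↮z)`, `c = P(s↔x, s↔y, s↮z)`, `P = P(s↮z)`,
BHK06 Theorem 1.3 (`bhk_same_cluster_events`: the cluster of `s` is positively associated given
`s ↮ z`) gives `a b ≤ c P`, and Harris (`prob_inter_le_prob_mul_prob_of_isLowerSet`: `{s ↮ z}` is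
decreasing, `{s ↔ x}` increasing) gives `a ≤ τ_x P`, `b ≤ τ_y P`; then
`P · (c − τ_x b − τ_y a + τ_x τ_y P) = (cP − ab) + (a − τ_x P)(b − τ_y P) ≥ 0`, and `P = 0`
forces `a = b = c = 0`.

**Corollary `cov_mem_mul_le` (the «(J2)» shape for one cluster):**

  `Cov(L_x, L_y L_z) ≤ Cov(L_x, L_y) + τ_y · Cov(L_x, L_z)`,

multiplied out: `P(s↔x,y,z) − τ_x P(s↔y,z) ≤ (P(s↔x,y) − τ_x τ_y) + τ_y (P(s↔x,z) − τ_x τ_z)`.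
The same shape with the avoidance `1_{R_z}` replaced by a connection of a SECOND root
(`(C4-q)`, M2-38) is false; with the avoidance it is a theorem — the mechanism of the cut-vertex
theorem for the weighted (PM) (MINE2-CUTU.md §4–§7).
-/

namespace Summit.Ventures.PercRepro2

namespace AvoidCentred

variable {V : Type*} {E : Type*} [Fintype E] [DecidableEq E] [Fintype V] [DecidableEq V]
  {R : Type*} [CommRing R] [LinearOrder R] [IsStrictOrderedRing R]

/-- **The avoidance-weighted centred product is nonnegative** (BHK 1.3 + Harris):
`P(s↔x, s↔y, s↮z) − τ_x P(s↔y, s↮z) − τ_y P(s↔x, s↮z) + τ_x τ_y P(s↮z) ≥ 0`. -/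
theorem centred_avoid_nonneg (p : E → R) (hp : IsProbVec p) (ends : E → Sym2 V) (s x y z : V) :
    0 ≤ prob p (connEvent ends s x ∩ connEvent ends s y ∩ (connEvent ends s z)ᶜ)
        - prob p (connEvent ends s x) * prob p (connEvent ends s y ∩ (connEvent ends s z)ᶜ)
        - prob p (connEvent ends s y) * prob p (connEvent ends s x ∩ (connEvent ends s z)ᶜ)
        + prob p (connEvent ends s x) * prob p (connEvent ends s y) *
            prob p (connEvent ends s z)ᶜ := by
  -- BHK 1.3 given `s ↮ z`, for the up-sets `{W | x ∈ W}`, `{W | y ∈ W}`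
  have hB := bhk_same_cluster_events p hp ends s z (𝓤 := {W : Set V | x ∈ W})
    (𝓥 := {W : Set V | y ∈ W}) (fun _ _ h hW => h hW) (fun _ _ h hW => h hW)
  rw [RProduct.clusterInEvent_mem_eq, RProduct.clusterInEvent_mem_eq] at hB
  -- Harris: `{s ↮ z}` is a down-set, `{s ↔ v}` an up-set
  have hL : IsLowerSet (connEvent ends s z)ᶜ := (isUpperSet_connEvent ends s z).compl
  have ha := prob_inter_le_prob_mul_prob_of_isLowerSet hp hL (isUpperSet_connEvent ends s x)
  have hb := prob_inter_le_prob_mul_prob_of_isLowerSet hp hL (isUpperSet_connEvent ends s y)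
  rw [Set.inter_comm] at ha hb
  -- names
  set a := prob p (connEvent ends s x ∩ (connEvent ends s z)ᶜ) with ha_def
  set b := prob p (connEvent ends s y ∩ (connEvent ends s z)ᶜ) with hb_def
  set c := prob p (connEvent ends s x ∩ connEvent ends s y ∩ (connEvent ends s z)ᶜ) with hc_def
  set P := prob p (connEvent ends s z)ᶜ with hP_def
  set τx := prob p (connEvent ends s x) with hτx
  set τy := prob p (connEvent ends s y) with hτy
  have hc0 : 0 ≤ c := prob_nonneg hp _
  have ha0 : 0 ≤ a := prob_nonneg hp _
  have hb0 : 0 ≤ b := prob_nonneg hp _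
  have hP0 : 0 ≤ P := prob_nonneg hp _
  have hca : c ≤ a := prob_mono hp (Set.inter_subset_inter_left _ Set.inter_subset_left)
  have key : 0 ≤ P * (c - τx * b - τy * a + τx * τy * P) := by
    have h2 : 0 ≤ (a - τx * P) * (b - τy * P) :=
      mul_nonneg_of_nonpos_of_nonpos (by linarith) (by linarith)
    nlinarith [hB, h2]
  rcases eq_or_lt_of_le hP0 with hP | hP
  · -- `P = 0` forces `a = b = c = 0`
    have ha' : a = 0 := by
      apply le_antisymm _ ha0
      calc a ≤ P * τx := ha
        _ = 0 := by rw [← hP]; ring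
    have hb' : b = 0 := by
      apply le_antisymm _ hb0
      calc b ≤ P * τy := hb
        _ = 0 := by rw [← hP]; ring
    have hc' : c = 0 := le_antisymm (hca.trans ha'.le) hc0
    rw [ha', hb', hc', ← hP]
    ring_nf
    exact le_refl _
  · exact (mul_nonneg_iff_of_pos_left hP).mp key

/-- **The «(J2)» inequality for one cluster**: `Cov(L_x, L_y L_z) ≤ Cov(L_x, L_y) + τ_y Cov(L_x, L_z)`,
i.e. `P(s↔x,y,z) − τ_x P(s↔y,z) ≤ (P(s↔x,y) − τ_x τ_y) + τ_y (P(s↔x,z) − τ_x τ_z)`. -/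
theorem cov_mem_mul_le (p : E → R) (hp : IsProbVec p) (ends : E → Sym2 V) (s x y z : V) :
    prob p (connEvent ends s x ∩ connEvent ends s y ∩ connEvent ends s z)
        - prob p (connEvent ends s x) * prob p (connEvent ends s y ∩ connEvent ends s z) ≤
      (prob p (connEvent ends s x ∩ connEvent ends s y)
          - prob p (connEvent ends s x) * prob p (connEvent ends s y))
        + prob p (connEvent ends s y) *
          (prob p (connEvent ends s x ∩ connEvent ends s z)
            - prob p (connEvent ends s x) * prob p (connEvent ends s z)) := by
  have h := centred_avoid_nonneg p hp ends s x y z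
  have e1 := prob_inter_add_prob_inter_compl p (connEvent ends s x ∩ connEvent ends s y)
    (connEvent ends s z)
  have e2 := prob_inter_add_prob_inter_compl p (connEvent ends s y) (connEvent ends s z)
  have e3 := prob_inter_add_prob_inter_compl p (connEvent ends s x) (connEvent ends s z)
  have e4 := prob_compl p (connEvent ends s z)
  have hc' : prob p (connEvent ends s x ∩ connEvent ends s y ∩ connEvent ends s z) =
      prob p (connEvent ends s x ∩ connEvent ends s y) -
        prob p (connEvent ends s x ∩ connEvent ends s y ∩ (connEvent ends s z)ᶜ) := by
    linarith [e1]
  have hb' : prob p (connEvent ends s y ∩ connEvent ends s z) =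
      prob p (connEvent ends s y) - prob p (connEvent ends s y ∩ (connEvent ends s z)ᶜ) := by
    linarith [e2]
  have ha' : prob p (connEvent ends s x ∩ connEvent ends s z) =
      prob p (connEvent ends s x) - prob p (connEvent ends s x ∩ (connEvent ends s z)ᶜ) := by
    linarith [e3]
  rw [hc', hb', ha']
  rw [e4] at h
  have : prob p (connEvent ends s x ∩ connEvent ends s y) -
        prob p (connEvent ends s x ∩ connEvent ends s y ∩ (connEvent ends s z)ᶜ) -
      prob p (connEvent ends s x) *
        (prob p (connEvent ends s y) - prob p (connEvent ends s y ∩ (connEvent ends s z)ᶜ)) =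
      (prob p (connEvent ends s x ∩ connEvent ends s y) -
          prob p (connEvent ends s x) * prob p (connEvent ends s y)) +
        prob p (connEvent ends s y) *
          (prob p (connEvent ends s x) - prob p (connEvent ends s x ∩ (connEvent ends s z)ᶜ) -
            prob p (connEvent ends s x) * prob p (connEvent ends s z)) -
      (prob p (connEvent ends s x ∩ connEvent ends s y ∩ (connEvent ends s z)ᶜ) -
          prob p (connEvent ends s x) * prob p (connEvent ends s y ∩ (connEvent ends s z)ᶜ) -
        prob p (connEvent ends s y) * prob p (connEvent ends s x ∩ (connEvent ends s z)ᶜ) +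
        prob p (connEvent ends s x) * prob p (connEvent ends s y) *
          (1 - prob p (connEvent ends s z))) := by ring
  linarith [h, this]

end AvoidCentred

end Summit.Ventures.PercRepro2
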